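import Summits.QuantumFields.QCD.Theorems.WilsonQuarkChessboardMassiveBridgeThresholdQCD
import Summits.QuantumFields.QCD.Theorems.WilsonQuarkChessboardMassiveBridgeStubDominationUV
import Summits.QuantumFields.QCD.Theorems.WilsonQuarkChessboardFlatCellOptimal

/-!
# Crux `WilsonQuarkChessboard.MassiveBridge` (stmt-QuantumFields-17577) is now UNCONDITIONALLY the shared
# item `QuarksAsStableAction.ThresholdQCD` (stmt-QuantumFields-8794)

Line `registered` (skeleton `Cruxes/MassiveBridge/Lines/birth.lean`, sha `f438cebc…`), continuation lead
`prover-line-stmt-QuantumFields-17577-c13-0`, 2026-08-17.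

The crux reads `QuarkChessboard → FlatCellOptimal → Θ` with `Θ` verbatim the statement of item
stmt-QuantumFields-8794 (`massiveBridge_iff_imp_thresholdQCD`, `Iff.rfl`, landed p151841).  Both hypotheses are
now THEOREMS of the tree:

* C = `QuarkChessboard` — `wilsonQuarkChessboardQuarkChessboard_proof` (item stmt-QuantumFields-9306);
* K = `FlatCellOptimal` — `wilsonQuarkChessboardFlatCellOptimal_proof` (item stmt-QuantumFields-9307, closed
  `proved` 2026-08-17T19:00:59Z: the diamagnetic inequality for `r = 1` antiperiodic Wilson determinants on even
  tori, `FlatCellOptimalDiamag.re_apDet_le_re`).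

Hence the last conditional of p151841 (`massiveBridge_iff_thresholdQCD_of_flatCellOptimal`) discharges and the
crux and item 8794 are the SAME proposition up to two proved, logically idle antecedents:

* `massiveBridge_iff_thresholdQCD` — `MassiveBridge ↔ ThresholdQCD` (no hypothesis left);
* `massiveBridge_imp_thresholdQCD` — a proof of this crux is literally a proof of item 8794 (the target of route
  `HeavyThresholdYMBridge`, crux rank 7 of `QuarksAsStableAction`): constructive four-dimensional `SU(3)` QCD with
  `N_f = 2, 3` massive Wilson quarks above an unpinned flavour-blind offset, with non-trivial non-Gaussian glue,
  non-decoupled flavour-changing pseudoscalars and a full-spectrum mass gap on the lattice side and in the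
  continuum — an open problem (Jaffe–Witten 2000 §5); the vacuity channel `¬K → MassiveBridge` of the crux attack
  is closed for good;
* `massiveBridge_dominationUV_iff_dynamicalQuarkContinuum'` — at stub level, the registered UV stub
  `stub_dominationUV : QuarkChessboard → FlatCellOptimal → ThresholdContinuum` (inlined) is now EQUIVALENT OUTRIGHT
  to the shared UV item `RenormalisedVafaWitten.DynamicalQuarkContinuum` (stmt-QuantumFields-8695), no longer only
  modulo K (sharpening `massiveBridge_dominationUV_iff_dynamicalQuarkContinuum`, p148760).

Consequence for the route (planners): with C and K proved, the deciding theorem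
`WilsonQuarkChessboard.closes : C → K → MassiveBridge → ChiralDescent → QCD` needs exactly
`ThresholdQCD` (item 8794) and `ChiralDescent` (item 17578, by definition `Θ → QCD`); the chessboard machinery is
discharged but feeds nothing downstream.

References: Jaffe–Witten 2000 §1, §5; Montvay–Münster 1994 §5.1 (flavour-blind critical mass — the offset `M₀`).
-/

namespace Summit.QuantumFields.QCD.Theorems

open Literature.MathematicalPhysics.QuantumFieldTheory
open Summit.QuantumFields.QCD.Theses
open Summit.QuantumFields.QCD.Theses.WilsonQuarkChessboard

/-- **`MassiveBridge ↔ ThresholdQCD`, unconditionally.**  Both chessboard hypotheses of the crux are proved in the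
tree (C: `wilsonQuarkChessboardQuarkChessboard_proof`; K: `wilsonQuarkChessboardFlatCellOptimal_proof`), so crux
stmt-QuantumFields-17577 and the shared threshold item stmt-QuantumFields-8794 are equivalent propositions.
[cite: JaffeWitten2000, §5] -/
theorem massiveBridge_iff_thresholdQCD : MassiveBridge ↔ QuarksAsStableAction.ThresholdQCD :=
  massiveBridge_iff_thresholdQCD_of_flatCellOptimal wilsonQuarkChessboardFlatCellOptimal_proof

/-- **A proof of the crux is a proof of item stmt-QuantumFields-8794** (both antecedents discharged by the landed
chessboard theorems).  CONDITIONAL on `MassiveBridge` — recorded as the cross-route edge: the day this crux closes,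
the target of `HeavyThresholdYMBridge` closes by this line. [cite: JaffeWitten2000, §5] -/
theorem massiveBridge_imp_thresholdQCD (hM : MassiveBridge) : QuarksAsStableAction.ThresholdQCD :=
  thresholdQCD_of_massiveBridge hM wilsonQuarkChessboardFlatCellOptimal_proof

/-- **The UV stub ⇔ `DynamicalQuarkContinuum`, unconditionally.**  The registered stub of line `registered`,
`stub_dominationUV : QuarkChessboard → FlatCellOptimal → ThresholdContinuum` (inlined over the Statement's
vocabulary, as in p148760), is EQUIVALENT to the shared UV item `RenormalisedVafaWitten.DynamicalQuarkContinuum`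
(stmt-QuantumFields-8695) with no hypothesis left: C and K are proved and idle, and the threshold offset is absorbed
into the flavour-blind critical mass (`massiveBridge_thresholdContinuum_iff_offsetFree`).
[cite: JaffeWitten2000, §5] [cite: MontvayMunster1994, §5.1] -/
theorem massiveBridge_dominationUV_iff_dynamicalQuarkContinuum' :
    (QuarkChessboard → FlatCellOptimal →
      ∀ Nf : ℕ, Nf = 2 ∨ Nf = 3 → ∃ M₀ : ℝ, 0 ≤ M₀ ∧ ∃ reg : QCDRegularisation Nf,
        reg.HasMassScaling ∧ ∀ m : Fin Nf → ℝ, (∀ f, M₀ < m f) →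
          ∃ (z shift : QCDField Nf → ℕ → ℝ) (T : OSData (QCDField Nf) 4),
            IsQCDAlong (reg.scheme m z shift) T ∧ T.IsNontrivial QCDField.glue ∧
              T.IsNonGaussian QCDField.glue ∧
                ∀ f g : Fin Nf, f ≠ g → T.IsNontrivial (QCDField.pseudoRe f g)) ↔
    Summit.QuantumFields.QCD.Theses.RenormalisedVafaWitten.DynamicalQuarkContinuum :=
  massiveBridge_dominationUV_iff_dynamicalQuarkContinuum.trans
    ⟨fun h => h wilsonQuarkChessboardFlatCellOptimal_proof, fun h _ => h⟩

/-- **Item stmt-QuantumFields-8695 is NECESSARY for the crux's UV stub** (and, by `massiveBridge_imp_thresholdQCD`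
with the gap clause dropped, for the crux): the modus-tollens reading planners use when ranking — any refutation of
`DynamicalQuarkContinuum` kills line `registered` at `stub_dominationUV`. [cite: JaffeWitten2000, §5] -/
theorem dynamicalQuarkContinuum_of_massiveBridge_dominationUV
    (h : QuarkChessboard → FlatCellOptimal →
      ∀ Nf : ℕ, Nf = 2 ∨ Nf = 3 → ∃ M₀ : ℝ, 0 ≤ M₀ ∧ ∃ reg : QCDRegularisation Nf,
        reg.HasMassScaling ∧ ∀ m : Fin Nf → ℝ, (∀ f, M₀ < m f) →
          ∃ (z shift : QCDField Nf → ℕ → ℝ) (T : OSData (QCDField Nf) 4),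
            IsQCDAlong (reg.scheme m z shift) T ∧ T.IsNontrivial QCDField.glue ∧
              T.IsNonGaussian QCDField.glue ∧
                ∀ f g : Fin Nf, f ≠ g → T.IsNontrivial (QCDField.pseudoRe f g)) :
    Summit.QuantumFields.QCD.Theses.RenormalisedVafaWitten.DynamicalQuarkContinuum :=
  massiveBridge_dominationUV_iff_dynamicalQuarkContinuum'.1 h

end Summit.QuantumFields.QCD.Theorems
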